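import Summits.CriticalPhenomena.PercolationContinuityZ3.Theorems.PercNearOneGluingNoHeavyLowerTailConditionedChampionExchangeSets
import HarnessLib

/-!
# `NoHeavyLowerTail` (stmt-CriticalPhenomena-4575) — THREE-RELAY SLIDING INEQUALITIES and the GLUED-PAIR EXCHANGE RATIO

Support file (lemma factory #8 `prim-lf-8`, gen 9; `--supports stmt-CriticalPhenomena-4575`).  No definitions, no named facts,
no sorries, no hypotheses on the weights.  `μ = prodBernoulli w` on `Fin n`, relays `A`, level `j`, `π(v) = {r ∈ A : v ↔ r}`,
`L_v = {|π(v)| ≤ j}` ("light"), `H_v = {|π(v)| > j}` ("heavy"); three vertices `a, b, q` (in the applications relays, `q` the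
reference relay of an exchange); `L_{ab} = {|π(a) ∪ π(b)| ≤ j}`, `H_{ab}` its complement (the lightness of the pair `{a,b}` GLUED).

For a "placement" of `b` — on `a`'s side (`a ↔ b`), separated (`a ↮ b ↮ q`), or on `q`'s side (`b ↔ q`) — write
`r = μ(a-side light, q-side heavy) / μ(a-side heavy, q-side light)` for the exchange odds of `a`'s side against `q`'s side.
The SLIDING inequalities say these odds increase as `b` slides from `a`'s side to `q`'s side; each is ONE instance of the
two-set exchange inequality of van den Berg–Häggström–Kahn (tree `setTwoClusterExchange`) in a suitable frame `(S, T)`: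
* `slide_join`   (frame `({a},{q})`):   `μ(a↔b↮q, L_a, H_q) · μ(b↔q↮a, H_a, L_q) ≤ μ(a↔b↮q, H_a, L_q) · μ(b↔q↮a, L_a, H_q)`;
* `slide_sep`    (frame `({a},{b,q})`): `μ(Sep, L_a, H_q) · μ(b↔q↮a, H_a, L_q) ≤ μ(Sep, H_a, L_q) · μ(b↔q↮a, L_a, H_q)`
  (`Sep` = `a, b, q` pairwise separated);
* `slide_union`  (frame `({a,b},{q})`): `μ(q↮{a,b}, L_{ab}, H_q) · μ(Sep, H_a, L_q) ≤ μ(q↮{a,b}, H_a, L_q) · μ(Sep, L_{ab}, H_q)`.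
Consequence (bookkeeping only): the **glued-pair exchange ratio bound**
* `gluedPair_exchange_le`:  `μ(q↮{a,b}, L_{ab}, H_q) · μ(H_a, L_q) ≤ μ(q↮{a,b}, H_{ab}, L_q) · μ(L_a, H_q)`,
  i.e. `cc^{ab} · CC_a ≤ CC^{ab} · cc_a`: gluing `b` onto `a` never raises `a`'s lightness odds against `q`
  (`cc_x = μ(L_x ∩ H_q)`, `CC_x = μ(H_x ∩ L_q)`; by symmetry also with `b` in place of `a`).
These are the structural lemmas behind the restricted-attachment exchange REX for two-port observers (prim-lf-8 HOME,
CANDIDATES v9 B9): seat census 0 violations / 16 644 (sliding) and 0 / 2 978 (glued pair, both members), all cells `k ≤ 7`.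
-/

noncomputable section

namespace Summit.CriticalPhenomena.PercolationContinuityZ3.Theorems

open MeasureTheory Set Literature.Probability.LatticeModels Literature.Probability.Percolation
open scoped Classical BigOperators

variable {n : ℕ}

namespace ThreeRelaySliding

open ConditionedChampionExchange ConditionedChampionExchangeSets

/-- The two-set separation event of `{a}` and `{b, q}` is `{a ↮ b} ∩ {a ↮ q}`. [folklore] -/
theorem sep_one_pair_eq (a b q : Fin n) :
    {ω : BondConfig (Fin n) | ∀ s ∈ ({a} : Set (Fin n)), ∀ t ∈ ({b, q} : Set (Fin n)), ¬ (openGraph ω).Reachable s t} =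
      (openConn a b : Set (BondConfig (Fin n)))ᶜ ∩ (openConn a q : Set (BondConfig (Fin n)))ᶜ := by
  ext ω
  simp only [mem_setOf_eq, mem_singleton_iff, forall_eq, mem_insert_iff, forall_eq_or_imp, mem_inter_iff, mem_compl_iff]
  rfl

/-- A light block and a heavy block are different blocks: `L_x ∩ H_y ⊆ {x ↮ y}`. [folklore] -/
theorem light_heavy_subset_compl (A : Finset (Fin n)) (x y : Fin n) (j : ℕ) :
    ({ω : BondConfig (Fin n) | (A.filter fun r => ω ∈ openConn x r).card ≤ j} ∩
        {ω | j < (A.filter fun r => ω ∈ openConn y r).card}) ⊆ (openConn x y : Set (BondConfig (Fin n)))ᶜ := by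
  rintro ω ⟨hl, hh⟩ hxy
  simp only [mem_setOf_eq] at hl hh
  rw [filter_eq_of_openConn A hxy] at hl
  exact absurd hl (not_le.2 hh)

/-- `{|π(a) ∪ π(b)| ≤ j}` is of type `(−)` for `(C_{{a,b}}, C_T)`: it survives shrinking `C_{{a,b}}`. [folklore] -/
theorem unionLight_typeMinus (A : Finset (Fin n)) (a b : Fin n) (T : Set (Fin n)) (j : ℕ) ⦃ω ω' : BondConfig (Fin n)⦄
    (hs : (⋃ s ∈ ({a, b} : Set (Fin n)), openEdgeCluster ω' s) ⊆ (⋃ s ∈ ({a, b} : Set (Fin n)), openEdgeCluster ω s))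
    (ht : (⋃ t ∈ T, openEdgeCluster ω t) ⊆ (⋃ t ∈ T, openEdgeCluster ω' t))
    (h : ω ∈ {ω : BondConfig (Fin n) | (A.filter fun r => ω ∈ openConn a r ∨ ω ∈ openConn b r).card ≤ j}) :
    ω' ∈ {ω : BondConfig (Fin n) | (A.filter fun r => ω ∈ openConn a r ∨ ω ∈ openConn b r).card ≤ j} := by
  simp only [mem_setOf_eq] at h ⊢
  refine le_trans (Finset.card_le_card fun r hr => ?_) h
  simp only [Finset.mem_filter] at hr ⊢
  refine ⟨hr.1, ?_⟩
  rcases hr.2 with h' | h'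
  · exact Or.inl (TwoSetExchange.typePlus_openConn_of_mem ({a, b} : Set (Fin n)) T (mem_insert a {b}) r hs ht h')
  · exact Or.inr (TwoSetExchange.typePlus_openConn_of_mem ({a, b} : Set (Fin n)) T
      (mem_insert_of_mem a (mem_singleton b)) r hs ht h')

/-- **Sliding, joined placements** (frame `({a},{q})`, BHK two-set exchange with `A₁ = {a↔b}`, `B₁ = L_a ∩ H_q`,
`A₂ = H_a ∩ L_q`, `B₂ = {q↔b}`):
`μ({a↮q} ∩ {a↔b} ∩ L_a ∩ H_q) · μ({a↮q} ∩ H_a ∩ L_q ∩ {q↔b}) ≤ μ({a↮q} ∩ {a↔b} ∩ H_a ∩ L_q) · μ({a↮q} ∩ L_a ∩ H_q ∩ {q↔b})`.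
[cite: VandenbergHaggstromKahn2005, Thm. 2.1 (p. 9) at q = 1 — corollary] -/
theorem slide_join (w : Sym2 (Fin n) → unitInterval) (A : Finset (Fin n)) (a b q : Fin n) (j : ℕ) :
    (prodBernoulli w).real ((openConn a q : Set (BondConfig (Fin n)))ᶜ ∩
        ((openConn a b : Set (BondConfig (Fin n))) ∩
          ({ω | (A.filter fun r => ω ∈ openConn a r).card ≤ j} ∩ {ω | j < (A.filter fun r => ω ∈ openConn q r).card}))) *
      (prodBernoulli w).real ((openConn a q : Set (BondConfig (Fin n)))ᶜ ∩
        (({ω | j < (A.filter fun r => ω ∈ openConn a r).card} ∩ {ω | (A.filter fun r => ω ∈ openConn q r).card ≤ j}) ∩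
          (openConn q b : Set (BondConfig (Fin n))))) ≤
    (prodBernoulli w).real ((openConn a q : Set (BondConfig (Fin n)))ᶜ ∩
        ((openConn a b : Set (BondConfig (Fin n))) ∩
          ({ω | j < (A.filter fun r => ω ∈ openConn a r).card} ∩ {ω | (A.filter fun r => ω ∈ openConn q r).card ≤ j}))) *
      (prodBernoulli w).real ((openConn a q : Set (BondConfig (Fin n)))ᶜ ∩
        (({ω | (A.filter fun r => ω ∈ openConn a r).card ≤ j} ∩ {ω | j < (A.filter fun r => ω ∈ openConn q r).card}) ∩
          (openConn q b : Set (BondConfig (Fin n))))) := by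
  have ha : a ∈ ({a} : Set (Fin n)) := mem_singleton a
  have hq : q ∈ ({q} : Set (Fin n)) := mem_singleton q
  have key := setTwoClusterExchange w ({a} : Set (Fin n)) ({q} : Set (Fin n))
    (A₁ := (openConn a b : Set (BondConfig (Fin n))))
    (A₂ := {ω | j < (A.filter fun r => ω ∈ openConn a r).card} ∩ {ω | (A.filter fun r => ω ∈ openConn q r).card ≤ j})
    (B₁ := {ω | (A.filter fun r => ω ∈ openConn a r).card ≤ j} ∩ {ω | j < (A.filter fun r => ω ∈ openConn q r).card})
    (B₂ := (openConn q b : Set (BondConfig (Fin n))))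
    (fun ω ω' hs ht h => TwoSetExchange.typePlus_openConn_of_mem _ _ ha b hs ht h)
    (fun ω ω' hs ht h => ⟨heavy_typePlus_of_mem A _ _ ha j hs ht h.1, light_typePlus_of_mem A _ _ hq j hs ht h.2⟩)
    (fun ω ω' hs ht h => ⟨light_typePlus_of_mem A _ _ ha j ht hs h.1, heavy_typePlus_of_mem A _ _ hq j ht hs h.2⟩)
    (fun ω ω' hs ht h => TwoSetExchange.typeMinus_openConn_of_mem _ _ hq b hs ht h)
  rw [sep_singletons_eq a q] at key
  exact key

/-- **Sliding, separated versus joined to `q`** (frame `({a},{b,q})`, `A₁ = {b↮q}`, `B₁ = L_a ∩ H_q`, `A₂ = H_a ∩ L_q`, `B₂ = {b↔q}`):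
with `D' = {a↮b} ∩ {a↮q}`,
`μ(D' ∩ {b↮q} ∩ L_a ∩ H_q) · μ(D' ∩ H_a ∩ L_q ∩ {b↔q}) ≤ μ(D' ∩ {b↮q} ∩ H_a ∩ L_q) · μ(D' ∩ L_a ∩ H_q ∩ {b↔q})`
("the odds of `a` light & `q` heavy against `a` heavy & `q` light are larger when `b` hangs on `q` than when `b` is separated").
[cite: VandenbergHaggstromKahn2005, Thm. 2.1 (p. 9) at q = 1 — corollary] -/
theorem slide_sep (w : Sym2 (Fin n) → unitInterval) (A : Finset (Fin n)) (a b q : Fin n) (j : ℕ) :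
    (prodBernoulli w).real (((openConn a b : Set (BondConfig (Fin n)))ᶜ ∩ (openConn a q : Set (BondConfig (Fin n)))ᶜ) ∩
        ((openConn b q : Set (BondConfig (Fin n)))ᶜ ∩
          ({ω | (A.filter fun r => ω ∈ openConn a r).card ≤ j} ∩ {ω | j < (A.filter fun r => ω ∈ openConn q r).card}))) *
      (prodBernoulli w).real (((openConn a b : Set (BondConfig (Fin n)))ᶜ ∩ (openConn a q : Set (BondConfig (Fin n)))ᶜ) ∩
        (({ω | j < (A.filter fun r => ω ∈ openConn a r).card} ∩ {ω | (A.filter fun r => ω ∈ openConn q r).card ≤ j}) ∩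
          (openConn b q : Set (BondConfig (Fin n))))) ≤
    (prodBernoulli w).real (((openConn a b : Set (BondConfig (Fin n)))ᶜ ∩ (openConn a q : Set (BondConfig (Fin n)))ᶜ) ∩
        ((openConn b q : Set (BondConfig (Fin n)))ᶜ ∩
          ({ω | j < (A.filter fun r => ω ∈ openConn a r).card} ∩ {ω | (A.filter fun r => ω ∈ openConn q r).card ≤ j}))) *
      (prodBernoulli w).real (((openConn a b : Set (BondConfig (Fin n)))ᶜ ∩ (openConn a q : Set (BondConfig (Fin n)))ᶜ) ∩
        (({ω | (A.filter fun r => ω ∈ openConn a r).card ≤ j} ∩ {ω | j < (A.filter fun r => ω ∈ openConn q r).card}) ∩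
          (openConn b q : Set (BondConfig (Fin n))))) := by
  have ha : a ∈ ({a} : Set (Fin n)) := mem_singleton a
  have hb : b ∈ ({b, q} : Set (Fin n)) := mem_insert b {q}
  have hq : q ∈ ({b, q} : Set (Fin n)) := mem_insert_of_mem b (mem_singleton q)
  have key := setTwoClusterExchange w ({a} : Set (Fin n)) ({b, q} : Set (Fin n))
    (A₁ := (openConn b q : Set (BondConfig (Fin n)))ᶜ)
    (A₂ := {ω | j < (A.filter fun r => ω ∈ openConn a r).card} ∩ {ω | (A.filter fun r => ω ∈ openConn q r).card ≤ j})
    (B₁ := {ω | (A.filter fun r => ω ∈ openConn a r).card ≤ j} ∩ {ω | j < (A.filter fun r => ω ∈ openConn q r).card})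
    (B₂ := (openConn b q : Set (BondConfig (Fin n))))
    (fun ω ω' hs ht h => TwoSetExchange.typePlus_not_openConn_of_mem _ _ hb q hs ht h)
    (fun ω ω' hs ht h => ⟨heavy_typePlus_of_mem A _ _ ha j hs ht h.1, light_typePlus_of_mem A _ _ hq j hs ht h.2⟩)
    (fun ω ω' hs ht h => ⟨light_typePlus_of_mem A _ _ ha j ht hs h.1, heavy_typePlus_of_mem A _ _ hq j ht hs h.2⟩)
    (fun ω ω' hs ht h => TwoSetExchange.typeMinus_openConn_of_mem _ _ hb q hs ht h)
  rw [sep_one_pair_eq a b q] at key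
  exact key

/-- **Sliding, glued pair versus separated** (frame `({a,b},{q})`, `A₁ = Ω`, `B₁ = L_{ab} ∩ H_q`, `A₂ = H_a ∩ L_q`, `B₂ = {a↮b}`):
with `D₀ = {a↮q} ∩ {b↮q}`,
`μ(D₀ ∩ L_{ab} ∩ H_q) · μ(D₀ ∩ H_a ∩ L_q ∩ {a↮b}) ≤ μ(D₀ ∩ H_a ∩ L_q) · μ(D₀ ∩ L_{ab} ∩ H_q ∩ {a↮b})`.
[cite: VandenbergHaggstromKahn2005, Thm. 2.1 (p. 9) at q = 1 — corollary] -/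
theorem slide_union (w : Sym2 (Fin n) → unitInterval) (A : Finset (Fin n)) (a b q : Fin n) (j : ℕ) :
    (prodBernoulli w).real (((openConn a q : Set (BondConfig (Fin n)))ᶜ ∩ (openConn b q : Set (BondConfig (Fin n)))ᶜ) ∩
        ({ω | (A.filter fun r => ω ∈ openConn a r ∨ ω ∈ openConn b r).card ≤ j} ∩
          {ω | j < (A.filter fun r => ω ∈ openConn q r).card})) *
      (prodBernoulli w).real (((openConn a q : Set (BondConfig (Fin n)))ᶜ ∩ (openConn b q : Set (BondConfig (Fin n)))ᶜ) ∩
        (({ω | j < (A.filter fun r => ω ∈ openConn a r).card} ∩ {ω | (A.filter fun r => ω ∈ openConn q r).card ≤ j}) ∩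
          (openConn a b : Set (BondConfig (Fin n)))ᶜ)) ≤
    (prodBernoulli w).real (((openConn a q : Set (BondConfig (Fin n)))ᶜ ∩ (openConn b q : Set (BondConfig (Fin n)))ᶜ) ∩
        ({ω | j < (A.filter fun r => ω ∈ openConn a r).card} ∩ {ω | (A.filter fun r => ω ∈ openConn q r).card ≤ j})) *
      (prodBernoulli w).real (((openConn a q : Set (BondConfig (Fin n)))ᶜ ∩ (openConn b q : Set (BondConfig (Fin n)))ᶜ) ∩
        (({ω | (A.filter fun r => ω ∈ openConn a r ∨ ω ∈ openConn b r).card ≤ j} ∩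
          {ω | j < (A.filter fun r => ω ∈ openConn q r).card}) ∩ (openConn a b : Set (BondConfig (Fin n)))ᶜ)) := by
  have ha : a ∈ ({a, b} : Set (Fin n)) := mem_insert a {b}
  have hq : q ∈ ({q} : Set (Fin n)) := mem_singleton q
  have key := setTwoClusterExchange w ({a, b} : Set (Fin n)) ({q} : Set (Fin n))
    (A₁ := univ)
    (A₂ := {ω | j < (A.filter fun r => ω ∈ openConn a r).card} ∩ {ω | (A.filter fun r => ω ∈ openConn q r).card ≤ j})
    (B₁ := {ω | (A.filter fun r => ω ∈ openConn a r ∨ ω ∈ openConn b r).card ≤ j} ∩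
      {ω | j < (A.filter fun r => ω ∈ openConn q r).card})
    (B₂ := (openConn a b : Set (BondConfig (Fin n)))ᶜ)
    (fun _ _ _ _ _ => mem_univ _)
    (fun ω ω' hs ht h => ⟨heavy_typePlus_of_mem A _ _ ha j hs ht h.1, light_typePlus_of_mem A _ _ hq j hs ht h.2⟩)
    (fun ω ω' hs ht h => ⟨unionLight_typeMinus A a b _ j hs ht h.1, heavy_typePlus_of_mem A _ _ hq j ht hs h.2⟩)
    (fun ω ω' hs ht h => TwoSetExchange.typeMinus_not_openConn_of_mem _ _ ha b hs ht h)
  rw [sep_pair_eq a b q] at key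
  simpa only [univ_inter] using key


/-- **Glued-pair exchange ratio bound (GLUE-R).**  For any three vertices `a, b, q`:
`μ({a↮q}∩{b↮q} ∩ L_{ab} ∩ H_q) · μ(H_a ∩ L_q) ≤ μ({a↮q}∩{b↮q} ∩ H_{ab} ∩ L_q) · μ(L_a ∩ H_q)`,
i.e. `cc^{ab} · CC_a ≤ CC^{ab} · cc_a`: gluing `b` onto `a` does not raise `a`'s lightness odds against `q`.
Proof: split `cc_a = μ(D₀∩L_a∩H_q) + c`, `CC_a = μ(D₀∩H_a∩L_q) + C` along `{q↔b}` (`c, C` = the `b↔q↮a` pattern masses),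
`cc^{ab} = c^{ab} + n` along `{a↔b}`; then `cc^{ab} ≤ μ(D₀∩L_a∩H_q)`, `μ(D₀∩H_a∩L_q) ≤ CC^{ab}`, and
`c^{ab}·C ≤ C^{ab}·c` (`slide_join`), `n·C ≤ N₁·c` (`slide_sep`) with `C^{ab} + N₁ = μ(D₀∩H_a∩L_q)`. [this work] -/
theorem gluedPair_exchange_le (w : Sym2 (Fin n) → unitInterval) (A : Finset (Fin n)) (a b q : Fin n) (j : ℕ) :
    (prodBernoulli w).real (((openConn a q : Set (BondConfig (Fin n)))ᶜ ∩ (openConn b q : Set (BondConfig (Fin n)))ᶜ) ∩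
        ({ω | (A.filter fun r => ω ∈ openConn a r ∨ ω ∈ openConn b r).card ≤ j} ∩
          {ω | j < (A.filter fun r => ω ∈ openConn q r).card})) *
      (prodBernoulli w).real ({ω : BondConfig (Fin n) | j < (A.filter fun r => ω ∈ openConn a r).card} ∩
        {ω | (A.filter fun r => ω ∈ openConn q r).card ≤ j}) ≤
    (prodBernoulli w).real (((openConn a q : Set (BondConfig (Fin n)))ᶜ ∩ (openConn b q : Set (BondConfig (Fin n)))ᶜ) ∩
        ({ω | j < (A.filter fun r => ω ∈ openConn a r ∨ ω ∈ openConn b r).card} ∩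
          {ω | (A.filter fun r => ω ∈ openConn q r).card ≤ j})) *
      (prodBernoulli w).real ({ω : BondConfig (Fin n) | (A.filter fun r => ω ∈ openConn a r).card ≤ j} ∩
        {ω | j < (A.filter fun r => ω ∈ openConn q r).card}) := by
  set μ := prodBernoulli w with hμ
  set Kaq : Set (BondConfig (Fin n)) := (openConn a q : Set (BondConfig (Fin n))) with hKaq
  set Kbq : Set (BondConfig (Fin n)) := (openConn b q : Set (BondConfig (Fin n))) with hKbq
  set Kab : Set (BondConfig (Fin n)) := (openConn a b : Set (BondConfig (Fin n))) with hKab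
  set La : Set (BondConfig (Fin n)) := {ω | (A.filter fun r => ω ∈ openConn a r).card ≤ j} with hLa
  set Ha : Set (BondConfig (Fin n)) := {ω | j < (A.filter fun r => ω ∈ openConn a r).card} with hHa
  set Lq : Set (BondConfig (Fin n)) := {ω | (A.filter fun r => ω ∈ openConn q r).card ≤ j} with hLq
  set Hq : Set (BondConfig (Fin n)) := {ω | j < (A.filter fun r => ω ∈ openConn q r).card} with hHq
  set Lab : Set (BondConfig (Fin n)) := {ω | (A.filter fun r => ω ∈ openConn a r ∨ ω ∈ openConn b r).card ≤ j} with hLab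
  set Hab : Set (BondConfig (Fin n)) := {ω | j < (A.filter fun r => ω ∈ openConn a r ∨ ω ∈ openConn b r).card} with hHab
  have hmeas : ∀ s : Set (BondConfig (Fin n)), MeasurableSet s := fun _ => MeasurableSet.of_discrete
  have hnn : ∀ s : Set (BondConfig (Fin n)), 0 ≤ μ.real s := fun _ => measureReal_nonneg
  have mono : ∀ {s t : Set (BondConfig (Fin n))}, s ⊆ t → μ.real s ≤ μ.real t :=
    fun h => measureReal_mono h (measure_ne_top μ _)
  have split : ∀ (F K : Set (BondConfig (Fin n))), μ.real F = μ.real (F ∩ K) + μ.real (F ∩ Kᶜ) := by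
    intro F K
    rw [← Set.sdiff_eq]
    exact (measureReal_inter_add_sdiff (μ := μ) (s := F) (t := K) (hmeas _)).symm
  -- `{q ↔ b} = {b ↔ q}`
  have hKqb : (openConn q b : Set (BondConfig (Fin n))) = Kbq := by rw [hKbq, KNPreFKG.openConn_symm q b]
  -- elementary inclusions
  have hLH : La ∩ Hq ⊆ Kaqᶜ := light_heavy_subset_compl A a q j
  have hHL : Ha ∩ Lq ⊆ Kaqᶜ := by
    intro ω hω hk
    have := light_heavy_subset_compl A q a j ⟨hω.2, hω.1⟩
    rw [KNPreFKG.openConn_symm q a] at this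
    exact this hk
  have hLabLa : Lab ⊆ La := by
    intro ω hω
    simp only [hLab, hLa, mem_setOf_eq] at hω ⊢
    exact le_trans (Finset.card_le_card fun r hr => by
      simp only [Finset.mem_filter] at hr ⊢; exact ⟨hr.1, Or.inl hr.2⟩) hω
  have hHaHab : Ha ⊆ Hab := by
    intro ω hω
    simp only [hHab, hHa, mem_setOf_eq] at hω ⊢
    exact lt_of_lt_of_le hω (Finset.card_le_card fun r hr => by
      simp only [Finset.mem_filter] at hr ⊢; exact ⟨hr.1, Or.inl hr.2⟩)
  -- on `{a ↔ b}` the pair count is `a`'s count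
  have hfilt : ∀ ω : BondConfig (Fin n), ω ∈ Kab →
      (A.filter fun r => ω ∈ openConn a r ∨ ω ∈ openConn b r) = (A.filter fun r => ω ∈ openConn a r) := by
    intro ω hk
    have e := filter_eq_of_openConn A (x := a) (c := b) hk
    ext r
    simp only [Finset.mem_filter, and_congr_right_iff]
    intro hr
    constructor
    · rintro (h | h)
      · exact h
      · have : r ∈ A.filter fun r => ω ∈ openConn b r := Finset.mem_filter.2 ⟨hr, h⟩
        rw [← e] at this
        exact (Finset.mem_filter.1 this).2
    · exact fun h => Or.inl h
  have hKabLab : Kab ∩ Lab = Kab ∩ La := by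
    ext ω
    simp only [mem_inter_iff, hLab, hLa, mem_setOf_eq, and_congr_right_iff]
    intro hk
    rw [hfilt ω hk]
  -- `a ↔ b`, `a ↮ q` ⟹ `b ↮ q`;  `b ↔ q`, `a ↮ q` ⟹ `a ↮ b`
  have hD0Kab : Kaqᶜ ∩ Kbqᶜ ∩ Kab = Kaqᶜ ∩ Kab := by
    ext ω
    simp only [mem_inter_iff, mem_compl_iff]
    constructor
    · rintro ⟨⟨h1, -⟩, h3⟩; exact ⟨h1, h3⟩
    · rintro ⟨h1, h3⟩
      refine ⟨⟨h1, fun h2 => h1 ?_⟩, h3⟩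
      exact (show (openGraph ω).Reachable a b from h3).trans h2
  have hKbqKab : Kaqᶜ ∩ Kbq = Kabᶜ ∩ Kaqᶜ ∩ Kbq := by
    ext ω
    simp only [mem_inter_iff, mem_compl_iff]
    constructor
    · rintro ⟨h1, h2⟩
      refine ⟨⟨fun h3 => h1 ?_, h1⟩, h2⟩
      exact (show (openGraph ω).Reachable a b from h3).trans h2
    · rintro ⟨⟨-, h1⟩, h2⟩; exact ⟨h1, h2⟩
  have hSep : Kaqᶜ ∩ Kbqᶜ ∩ Kabᶜ = Kabᶜ ∩ Kaqᶜ ∩ Kbqᶜ := by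
    ext ω; simp only [mem_inter_iff, mem_compl_iff]; tauto
  -- the masses
  set g₁ := μ.real (Kaqᶜ ∩ Kbqᶜ ∩ (Lab ∩ Hq)) with hg₁
  set G₁ := μ.real (Kaqᶜ ∩ Kbqᶜ ∩ (Hab ∩ Lq)) with hG₁
  set B₁ := μ.real (Kaqᶜ ∩ Kbqᶜ ∩ (La ∩ Hq)) with hB₁
  set A₁ := μ.real (Kaqᶜ ∩ Kbqᶜ ∩ (Ha ∩ Lq)) with hA₁
  set c := μ.real (Kaqᶜ ∩ ((La ∩ Hq) ∩ Kbq)) with hc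
  set C := μ.real (Kaqᶜ ∩ ((Ha ∩ Lq) ∩ Kbq)) with hC
  set cab := μ.real (Kaqᶜ ∩ (Kab ∩ (La ∩ Hq))) with hcab
  set Cab := μ.real (Kaqᶜ ∩ (Kab ∩ (Ha ∩ Lq))) with hCab
  set n₁ := μ.real (Kabᶜ ∩ Kaqᶜ ∩ (Kbqᶜ ∩ (La ∩ Hq))) with hn₁
  set N₁ := μ.real (Kabᶜ ∩ Kaqᶜ ∩ (Kbqᶜ ∩ (Ha ∩ Lq))) with hN₁
  set nn := μ.real (Kaqᶜ ∩ Kbqᶜ ∩ (Lab ∩ Hq) ∩ Kabᶜ) with hnn'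
  -- (1) `cc_a = B₁ + c`, `CC_a = A₁ + C`
  have e_cc : μ.real (La ∩ Hq) = B₁ + c := by
    rw [split (La ∩ Hq) Kbq, add_comm]
    congr 1
    · congr 1
      ext ω; simp only [mem_inter_iff, mem_compl_iff]
      constructor
      · rintro ⟨h, hk⟩; exact ⟨⟨hLH h, hk⟩, h⟩
      · rintro ⟨⟨-, hk⟩, h⟩; exact ⟨h, hk⟩
    · congr 1
      ext ω; simp only [mem_inter_iff]
      constructor
      · rintro ⟨h, hk⟩; exact ⟨hLH h, h, hk⟩
      · rintro ⟨-, h, hk⟩; exact ⟨h, hk⟩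
  have e_CC : μ.real (Ha ∩ Lq) = A₁ + C := by
    rw [split (Ha ∩ Lq) Kbq, add_comm]
    congr 1
    · congr 1
      ext ω; simp only [mem_inter_iff, mem_compl_iff]
      constructor
      · rintro ⟨h, hk⟩; exact ⟨⟨hHL h, hk⟩, h⟩
      · rintro ⟨⟨-, hk⟩, h⟩; exact ⟨h, hk⟩
    · congr 1
      ext ω; simp only [mem_inter_iff]
      constructor
      · rintro ⟨h, hk⟩; exact ⟨hHL h, h, hk⟩
      · rintro ⟨-, h, hk⟩; exact ⟨h, hk⟩
  -- (2) `g₁ = cab + nn`, `nn ≤ n₁`, `g₁ ≤ B₁`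
  have e_g : g₁ = cab + nn := by
    rw [hg₁, split (Kaqᶜ ∩ Kbqᶜ ∩ (Lab ∩ Hq)) Kab]
    congr 1
    congr 1
    ext ω; simp only [mem_inter_iff, mem_compl_iff]
    constructor
    · rintro ⟨⟨⟨h1, h2⟩, hl, hh⟩, hk⟩
      refine ⟨h1, hk, ?_, hh⟩
      have : ω ∈ Kab ∩ Lab := ⟨hk, hl⟩
      rw [hKabLab] at this
      exact this.2
    · rintro ⟨h1, hk, hl, hh⟩
      have hb : ω ∉ Kbq := fun h2 => h1 ((show (openGraph ω).Reachable a b from hk).trans h2)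
      have : ω ∈ Kab ∩ La := ⟨hk, hl⟩
      rw [← hKabLab] at this
      exact ⟨⟨⟨h1, hb⟩, this.2, hh⟩, hk⟩
  have i_n : nn ≤ n₁ := mono (by
    rintro ω ⟨⟨⟨h1, h2⟩, hl, hh⟩, hk⟩
    exact ⟨⟨hk, h1⟩, h2, hLabLa hl, hh⟩)
  have i_gB : g₁ ≤ B₁ := mono (by
    rintro ω ⟨hD, hl, hh⟩; exact ⟨hD, hLabLa hl, hh⟩)
  -- (3) `A₁ = Cab + N₁`, `A₁ ≤ G₁`
  have e_A : A₁ = Cab + N₁ := by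
    rw [hA₁, split (Kaqᶜ ∩ Kbqᶜ ∩ (Ha ∩ Lq)) Kab]
    congr 1
    · congr 1
      ext ω; simp only [mem_inter_iff, mem_compl_iff]
      constructor
      · rintro ⟨⟨⟨h1, -⟩, hha, hl⟩, hk⟩; exact ⟨h1, hk, hha, hl⟩
      · rintro ⟨h1, hk, hha, hl⟩
        exact ⟨⟨⟨h1, fun h2 => h1 ((show (openGraph ω).Reachable a b from hk).trans h2)⟩, hha, hl⟩, hk⟩
    · congr 1
      ext ω; simp only [mem_inter_iff, mem_compl_iff]; tauto
  have i_AG : A₁ ≤ G₁ := mono (by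
    rintro ω ⟨hD, hha, hl⟩; exact ⟨hD, hHaHab hha, hl⟩)
  -- (4) the two sliding inequalities
  have s1 : cab * C ≤ Cab * c := by
    have key := slide_join w A a b q j
    rw [hKqb] at key
    exact key
  have s2 : n₁ * C ≤ N₁ * c := by
    have key := slide_sep w A a b q j
    have eC : Kabᶜ ∩ Kaqᶜ ∩ ((Ha ∩ Lq) ∩ Kbq) = Kaqᶜ ∩ ((Ha ∩ Lq) ∩ Kbq) := by
      ext ω; simp only [mem_inter_iff, mem_compl_iff]
      constructor
      · rintro ⟨⟨-, h1⟩, h, hk⟩; exact ⟨h1, h, hk⟩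
      · rintro ⟨h1, h, hk⟩
        exact ⟨⟨fun h3 => h1 ((show (openGraph ω).Reachable a b from h3).trans hk), h1⟩, h, hk⟩
    have ec : Kabᶜ ∩ Kaqᶜ ∩ ((La ∩ Hq) ∩ Kbq) = Kaqᶜ ∩ ((La ∩ Hq) ∩ Kbq) := by
      ext ω; simp only [mem_inter_iff, mem_compl_iff]
      constructor
      · rintro ⟨⟨-, h1⟩, h, hk⟩; exact ⟨h1, h, hk⟩
      · rintro ⟨h1, h, hk⟩
        exact ⟨⟨fun h3 => h1 ((show (openGraph ω).Reachable a b from h3).trans hk), h1⟩, h, hk⟩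
    rw [eC, ec] at key
    exact key
  -- (5) assemble
  have hC0 : 0 ≤ C := hnn _
  have hc0 : 0 ≤ c := hnn _
  have hG0 : 0 ≤ G₁ := hnn _
  rw [e_cc, e_CC]
  have step1 : g₁ * A₁ ≤ G₁ * B₁ := by
    calc g₁ * A₁ ≤ B₁ * G₁ := mul_le_mul i_gB i_AG (hnn _) (hnn _)
      _ = G₁ * B₁ := mul_comm _ _
  have step2 : g₁ * C ≤ G₁ * c := by
    calc g₁ * C = cab * C + nn * C := by rw [e_g, add_mul]
      _ ≤ Cab * c + n₁ * C := add_le_add s1 (mul_le_mul_of_nonneg_right i_n hC0)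
      _ ≤ Cab * c + N₁ * c := by linarith [s2]
      _ = A₁ * c := by rw [e_A, add_mul]
      _ ≤ G₁ * c := mul_le_mul_of_nonneg_right i_AG hc0
  calc g₁ * (A₁ + C) = g₁ * A₁ + g₁ * C := mul_add _ _ _
    _ ≤ G₁ * B₁ + G₁ * c := add_le_add step1 step2
    _ = G₁ * (B₁ + c) := (mul_add _ _ _).symm

end ThreeRelaySliding

end Summit.CriticalPhenomena.PercolationContinuityZ3.Theorems

end
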